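import Summits.SmoothPoincare4.SmoothPoincare4.Theorems.SullivanDualTargetOfSympcap

/-!
# SmoothPoincare4 / SullivanDual — crux `Target` (stmt-SmoothPoincare4-7823), line `kaehler-jacket`:
# definitions (lead c6)

`StarJacketAt S p` — the folded apex of line `kaehler-jacket` at one puncture `(Σ, p)`: a JACKET
`F : Σ ∖ p → ℝ⁴` (a `C^∞` immersion off an inner puncture `q ≠ p`, equal to the inverted
recentred chart near `p`), chart radii `0 < μ < μ'` about `q` (closed `μ'`-ball inside the chart
and missing `p`), a smooth `u : ℝ⁴ → ℝ`, a linear isometry `A` of `ℝ⁴`, and a STAR COLLAR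
`Ψ : Σ ∖ p → ℝ⁴` of width `δ₁ > 0`: on the shell `|‖e_q x − c‖ − μ| < δ₁` (`c = e_q q`) it is a
`C^∞` embedding with `Ψ*ω₀ = F*ω₀`, on the chart sphere `‖e_q x − c‖ = μ` it is the star-shaped
model `θ ↦ e^{u(θ)/2} θ` through `θ = A⁻¹(μ⁻¹(e_q x − c))`, and it carries the `q`-side exactly to
the inside of the star-shaped hypersurface `{e^{u(θ)/2} θ}`.  The body is VERBATIM the matrix of
the skeleton stub `stub_starCollaredJacket` of `Cruxes/Target/Lines/kaehler_jacket.lean` (v4),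
i.e. the conjunction of the hypotheses of the landed `stub_ballExtension` after `q ≠ p`; by
Geiges' Liouville collar lemma (2008, Lemma 5.2.4) it is the v1 apex `stub_tightInnerSphere`
(contact-type inner chart-sphere, Liouville field outward, tight characteristic structure in
T-ext form) with the collar made explicit.

References: H. Geiges, *An Introduction to Contact Topology*, CUP 2008, Lemma 5.2.4 and
Lemma/Definition 1.4.5 [Geiges2008]; M. Gromov, *Partial Differential Relations* (1986), §2.2.2
(h-principle for immersions of open manifolds) [Gromov1986].
-/

noncomputable section

set_option linter.dupNamespace false

open scoped Manifold ContDiff Topology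
open Set Function
open Literature.Geometry.Kaehler (MForm IsSmoothForm IsClosedForm mextDeriv)
open Literature.Geometry.Symplectic (punctured InPuncturedChartBall stdSymplecticForm inversion
  invertedStdForm IsSymplecticStandardNearPoint AgreesWithInvertedChartNear)
open Literature.Topology.FourManifolds (HomotopySphere)

namespace Summit.SmoothPoincare4.SmoothPoincare4.Theorems.Target.KaehlerJacket

local notation "E4" => EuclideanSpace ℝ (Fin 4)

/-- **The star-collared jacket at `(Σ, p)`** (folded apex of line `kaehler-jacket`; see the module
docstring).  TRUE when `Σ ≅ S⁴` (`starJacketAt_of_nonempty_diffeomorph_sphere`, certificate file);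
for every `(Σ, p)` it implies a symplectic form standard near `p`, hence the matrix of `Target`.
[cite: Geiges2008, Lemma 5.2.4] -/
def StarJacketAt (S : HomotopySphere 4) (p : S.carrier) : Prop :=
  ∃ q : S.carrier, q ≠ p ∧
      ∃ (F : punctured p → E4) (μ μ' : ℝ) (A : E4 ≃ₗᵢ[ℝ] E4) (u : E4 → ℝ)
        (Ψ : punctured p → E4) (δ₁ : ℝ),
        (∀ x : punctured p, x.1 ≠ q →
          ContMDiffAt (𝓡 4) 𝓘(ℝ, E4) ∞ F x ∧ Injective (mfderiv (𝓡 4) 𝓘(ℝ, E4) F x)) ∧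
        AgreesWithInvertedChartNear p F ∧
        0 < μ ∧ μ < μ' ∧
        Metric.closedBall (extChartAt (𝓡 4) q q) μ' ⊆ (extChartAt (𝓡 4) q).target ∧
        (∀ y ∈ Metric.closedBall (extChartAt (𝓡 4) q q) μ', (extChartAt (𝓡 4) q).symm y ≠ p) ∧
        ContDiff ℝ ∞ u ∧ 0 < δ₁ ∧
        (∀ x : punctured p, x.1 ∈ (chartAt E4 q).source →
          |‖extChartAt (𝓡 4) q x.1 - extChartAt (𝓡 4) q q‖ - μ| < δ₁ →
          ContMDiffAt (𝓡 4) 𝓘(ℝ, E4) ∞ Ψ x ∧ Injective (mfderiv (𝓡 4) 𝓘(ℝ, E4) Ψ x)) ∧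
        (∀ x y : punctured p, x.1 ∈ (chartAt E4 q).source →
          |‖extChartAt (𝓡 4) q x.1 - extChartAt (𝓡 4) q q‖ - μ| < δ₁ →
          y.1 ∈ (chartAt E4 q).source →
          |‖extChartAt (𝓡 4) q y.1 - extChartAt (𝓡 4) q q‖ - μ| < δ₁ → Ψ x = Ψ y → x = y) ∧
        (∀ x : punctured p, x.1 ∈ (chartAt E4 q).source →
          |‖extChartAt (𝓡 4) q x.1 - extChartAt (𝓡 4) q q‖ - μ| < δ₁ →
          ∀ v w : TangentSpace (𝓡 4) x,
            stdSymplecticForm (mfderiv (𝓡 4) 𝓘(ℝ, E4) Ψ x v) (mfderiv (𝓡 4) 𝓘(ℝ, E4) Ψ x w) =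
              stdSymplecticForm (mfderiv (𝓡 4) 𝓘(ℝ, E4) F x v) (mfderiv (𝓡 4) 𝓘(ℝ, E4) F x w)) ∧
        (∀ x : punctured p, x.1 ∈ (chartAt E4 q).source →
          ‖extChartAt (𝓡 4) q x.1 - extChartAt (𝓡 4) q q‖ = μ →
          Ψ x = Real.exp (u (A.symm (μ⁻¹ • (extChartAt (𝓡 4) q x.1 - extChartAt (𝓡 4) q q))) / 2) •
            A.symm (μ⁻¹ • (extChartAt (𝓡 4) q x.1 - extChartAt (𝓡 4) q q))) ∧
        (∀ x : punctured p, x.1 ∈ (chartAt E4 q).source →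
          |‖extChartAt (𝓡 4) q x.1 - extChartAt (𝓡 4) q q‖ - μ| < δ₁ →
          (‖extChartAt (𝓡 4) q x.1 - extChartAt (𝓡 4) q q‖ < μ ↔
            ‖Ψ x‖ < Real.exp (u (‖Ψ x‖⁻¹ • Ψ x) / 2)))

/-- Unfolding (`Iff.rfl`; registered helper `helper_starJacketAt_iff`). [folklore] -/
theorem helper_starJacketAt_iff :
    ∀ (S : HomotopySphere 4) (p : S.carrier), StarJacketAt S p ↔
      ∃ q : S.carrier, q ≠ p ∧
      ∃ (F : punctured p → E4) (μ μ' : ℝ) (A : E4 ≃ₗᵢ[ℝ] E4) (u : E4 → ℝ)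
        (Ψ : punctured p → E4) (δ₁ : ℝ),
        (∀ x : punctured p, x.1 ≠ q →
          ContMDiffAt (𝓡 4) 𝓘(ℝ, E4) ∞ F x ∧ Injective (mfderiv (𝓡 4) 𝓘(ℝ, E4) F x)) ∧
        AgreesWithInvertedChartNear p F ∧
        0 < μ ∧ μ < μ' ∧
        Metric.closedBall (extChartAt (𝓡 4) q q) μ' ⊆ (extChartAt (𝓡 4) q).target ∧
        (∀ y ∈ Metric.closedBall (extChartAt (𝓡 4) q q) μ', (extChartAt (𝓡 4) q).symm y ≠ p) ∧
        ContDiff ℝ ∞ u ∧ 0 < δ₁ ∧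
        (∀ x : punctured p, x.1 ∈ (chartAt E4 q).source →
          |‖extChartAt (𝓡 4) q x.1 - extChartAt (𝓡 4) q q‖ - μ| < δ₁ →
          ContMDiffAt (𝓡 4) 𝓘(ℝ, E4) ∞ Ψ x ∧ Injective (mfderiv (𝓡 4) 𝓘(ℝ, E4) Ψ x)) ∧
        (∀ x y : punctured p, x.1 ∈ (chartAt E4 q).source →
          |‖extChartAt (𝓡 4) q x.1 - extChartAt (𝓡 4) q q‖ - μ| < δ₁ →
          y.1 ∈ (chartAt E4 q).source →
          |‖extChartAt (𝓡 4) q y.1 - extChartAt (𝓡 4) q q‖ - μ| < δ₁ → Ψ x = Ψ y → x = y) ∧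
        (∀ x : punctured p, x.1 ∈ (chartAt E4 q).source →
          |‖extChartAt (𝓡 4) q x.1 - extChartAt (𝓡 4) q q‖ - μ| < δ₁ →
          ∀ v w : TangentSpace (𝓡 4) x,
            stdSymplecticForm (mfderiv (𝓡 4) 𝓘(ℝ, E4) Ψ x v) (mfderiv (𝓡 4) 𝓘(ℝ, E4) Ψ x w) =
              stdSymplecticForm (mfderiv (𝓡 4) 𝓘(ℝ, E4) F x v) (mfderiv (𝓡 4) 𝓘(ℝ, E4) F x w)) ∧
        (∀ x : punctured p, x.1 ∈ (chartAt E4 q).source →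
          ‖extChartAt (𝓡 4) q x.1 - extChartAt (𝓡 4) q q‖ = μ →
          Ψ x = Real.exp (u (A.symm (μ⁻¹ • (extChartAt (𝓡 4) q x.1 - extChartAt (𝓡 4) q q))) / 2) •
            A.symm (μ⁻¹ • (extChartAt (𝓡 4) q x.1 - extChartAt (𝓡 4) q q))) ∧
        (∀ x : punctured p, x.1 ∈ (chartAt E4 q).source →
          |‖extChartAt (𝓡 4) q x.1 - extChartAt (𝓡 4) q q‖ - μ| < δ₁ →
          (‖extChartAt (𝓡 4) q x.1 - extChartAt (𝓡 4) q q‖ < μ ↔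
            ‖Ψ x‖ < Real.exp (u (‖Ψ x‖⁻¹ • Ψ x) / 2))) :=
  fun _ _ => Iff.rfl

end Summit.SmoothPoincare4.SmoothPoincare4.Theorems.Target.KaehlerJacket

end
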